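import Summits.BirchSwinnertonDyer.BirchSwinnertonDyer.Theorems.ResidualThetaTransportAtTwoResidualSignedLambdaLowerCMAtTwoDeepHalfAwayTwoLevelwise
import Summits.BirchSwinnertonDyer.BirchSwinnertonDyer.Theorems.ResidualThetaTransportAtTwoResidualSignedLambdaLowerCMAtTwoLayerPairingOfFunMackeyDual
import HarnessLib

/-!
# Sketch (stub-ideation k1 g16, technique «weaken / strengthen») — GLUE-7 CONCRETE in LAYER currency:
# the S₀-side levelwise call `DeepHalfLevelwiseAway.exists_admissible_prescribed_of_levelwise_orthogonal` (p694988)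
# consumes its orthogonality hypothesis ONLY ORBIT-SUMMED through per-orbit level characters `ψ_{w,i} : H¹(U_{n,w}, A_ρ[p^k]|) →+ ℤ/p^k`,
# and returns a class whose conjugate layer pairings `layerPairingOf … (g_{w,i} · c)` ARE the prescribed characters (a = 1).

Crux `ResidualThetaCountLowerPureAtTwo` (stmt-BirchSwinnertonDyer-26074), stub `stub_cmLambdaLower` = RSL_g (stmt-22608), line `onepair`
item 7 (S4₀ `stub_deepHalfAwayTwo`). Folder sketch of seat `planner-sidea-stub_cmLambdaLower-1-g16`; THEOREMS only, no `sorry`.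
BSD is NOT proved by any of this; RSL_g / 26074 stay OPEN. Everything is CONDITIONAL on the orbit-summed hypothesis `hsum`.

* §A `exists_local_components_layerPairingH1Of_eq` — SYNTHESIS: per-orbit characters `ψ i` ↦ a LOCAL class `a' ∈ H¹(ℚ_v, Maps(Γ/Γ_n, M))`
  whose Mackey components `x i` have `⟨x i, ·⟩_{n,N,v} = ψ i` (local Tate duality perfectness `layerPairingH1Of_bijective` +
  H¹-Mackey joint surjectivity `exists_local_forall_component_eq`).
* §B `localTatePairingZMod_canonical_local_shapiroLift_eq_sum` — READBACK of the hT₀-summand: `⟨a', loc_v(H¹(Ψ)(Sh b))⟩_v = Σ_i ⟨x i, loc_n(g_i · b)⟩`.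
* §C `layerLocOf_conjMap_eq_of_localization_shapiroLift_eq` / `layerPairingOf_conjMap_eq` — READBACK of the conclusion:
  `loc_v(Sh c) = a'` ⟹ `loc_n(g_i · c) = x i` ⟹ `layerPairingOf (g_i · c) = ψ i`.
* §E `exists_injective_zmodToAddCircle` / `sum_eq_zero_of_sum_val_nsmul_eq_zero` / `exists_zmodChar_of_nsmul_eq_zero` — CURRENCY:
  a character `χ : D →+ ℚ/ℤ` of an `N`-torsion group is `(ψ ·).val • (1/N)` for a unique `ψ : D →+ ℤ/N`, and `ℤ/N`-sums are read in `ℚ/ℤ`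
  faithfully (the step `χ w c ∘ jAway w n k ↦ ψ_{w,c}` from the AwayPins frame, and `Σ χ (locAway …) = 0 ↦ hsum`).
* §D `exists_admissible_layerPairingOf_eq_of_orbitSum_orthogonal` — the ONE-CALL S4₀ levelwise theorem in the currency of the AwayPins value pin:
  from `hsum : ∀ b [unr][inf][p], Σ_{w ∈ S₀} Σ_i ψ w i (loc_n(g_{w,i} · b)) = 0` to `∃ c [adm] ∧ ∀ w ∈ S₀ ∀ i, layerPairingOf … κ w n (g_{w,i} · c) = ψ w i`.
-/

set_option autoImplicit false
set_option linter.dupNamespace false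

noncomputable section

open scoped Classical

namespace Summit.BirchSwinnertonDyer.BirchSwinnertonDyer.Cruxes.ResidualThetaCountLowerPureAtTwo.SideaK1G16Away

open CategoryTheory Function Field NumberField IsDedekindDomain
  Literature.NumberTheory.EllipticCurves Literature.NumberTheory.EllipticCurves.CyclotomicLayer
  Literature.NumberTheory.EllipticCurves.GreenbergSelmer
  Literature.NumberTheory.GaloisRepresentations Literature.NumberTheory.GaloisRepresentations.DiscreteGaloisModule
  Literature.NumberTheory.GaloisCohomology ZpExtension
open Summit.BirchSwinnertonDyer.BirchSwinnertonDyer.Theorems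
open Summit.BirchSwinnertonDyer.BirchSwinnertonDyer.Theorems.ThetaTransport.LayerPairingNondegenerate
  (layerPairingH1Of_bijective localTatePairingZMod_canonical_coind_eq_sum_layerPairingH1Of)
open Summit.BirchSwinnertonDyer.BirchSwinnertonDyer.Theorems.ThetaTransport.LayerPairingMackeyDual
  (exists_local_forall_component_eq cohomologyMap_resCoindFinHomR_localization_shapiroLift)

section Generic

variable {M : Type} [AddCommGroup M] [TopologicalSpace M] [DiscreteTopology M] [Finite M]
  (ρM : DiscreteGaloisModule ℚ M) (N : ℕ) [NeZero N]
  (e : M → M → AlgebraicClosure ℚ)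
  (hμ : ∀ S T, e S T ^ N = 1)
  (hadd₁ : ∀ S₁ S₂ T, e (S₁ + S₂) T = e S₁ T * e S₂ T)
  (hadd₂ : ∀ S T₁ T₂, e S (T₁ + T₂) = e S T₁ * e S T₂)
  (hgal : ∀ (σ : absoluteGaloisGroup ℚ) (S T : M), σ • e S T = e (ρM σ S) (ρM σ T))
  {p : ℕ} [Fact p.Prime] (κ : ZpExtension ℚ p) (v : HeightOneSpectrum (𝓞 ℚ)) (n : ℕ)

/-! ## §A Synthesis of the prescribed local class from per-orbit level characters -/

/-- **SYNTHESIS.** For orbit representatives `g` (`hbij`) and per-orbit characters `ψ i : H¹(U_n, M|) →+ ℤ/N` there is a LOCAL class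
`a' ∈ H¹(ℚ_v, Maps(Γ_ℚ ⧸ Γ_n, M))` with Mackey components `x i` (`H¹(Φ_{g_iΓ_n}) a' = Sh(x i)`) such that `⟨x i, ·⟩_{n,N,v} = ψ i`
(left adjoint of the layer pairing onto: `layerPairingH1Of_bijective`; joint surjectivity `exists_local_forall_component_eq`).
[cite: MilneADT2006, Ch. I Cor. 2.3] [cite: NeukirchSchmidtWingberg2008, I §6 Prop. (1.6.4)] -/
theorem exists_local_components_layerPairingH1Of_eq [CompactSpace (absoluteGaloisGroup ℚ)]
    [CompactSpace (absoluteGaloisGroup (v.adicCompletion ℚ))] [Fintype (absoluteGaloisGroup ℚ ⧸ κ.layerSubgroup n)]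
    (hnondeg : ∀ T, (∀ S, e S T = 1) → T = 0) (hN : ∀ m : M, N • m = 0)
    {ι : Type} (g : ι → absoluteGaloisGroup ℚ)
    (hbij : Function.Bijective fun q : ι × (absoluteGaloisGroup (v.adicCompletion ℚ) ⧸ layerGroup κ v n) =>
      quotientMapOfHom (κ.layerSubgroup n) (resGalOfEmb (closureEmb (K := ℚ) (v.adicCompletion ℚ))) q.2 *
        (g q.1 : absoluteGaloisGroup ℚ ⧸ κ.layerSubgroup n))
    (ψ : ι → (continuousCohomology 1 (subgroupRep (localRepOf ρM v) (layerGroup κ v n)) →+ ZMod N)) :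
    ∃ (a' : galoisCohomology ((ρM.coind (κ.layerSubgroup n) (κ.isOpen_layerSubgroup n)).toLocal (Sum.inr v)) 1)
      (x : ι → continuousCohomology 1 (subgroupRep (localRepOf ρM v) (layerGroup κ v n))),
      (∀ i, layerPairingH1Of ρM N e hμ hadd₁ hadd₂ hgal κ v n (x i) = ψ i) ∧
      ∀ i, cohomologyMap (resCoindFinHomR ρM.toTopRep (κ.layerSubgroup n) (resGalOfEmb (closureEmb (K := ℚ) (v.adicCompletion ℚ)))
        (g i : absoluteGaloisGroup ℚ ⧸ κ.layerSubgroup n)) 1 a' = layerShapiroOf ρM κ v n (x i) := by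
  have hb := (layerPairingH1Of_bijective ρM N e hμ hadd₁ hadd₂ hgal κ v n hnondeg hN).1
  choose x hx using fun i => hb.2 (ψ i)
  obtain ⟨u, hu⟩ := exists_local_forall_component_eq ρM κ v n g hbij x
  exact ⟨u, x, hx, hu⟩

/-! ## §B Readback of the `hT₀`-summand: prescribed local class against `loc_v(H¹(Ψ)(Sh b))` -/

/-- **READBACK (hypothesis side).** For a local class `a'` with Mackey components `x i` and a layer class `b ∈ H¹(Γ_n, M)`:
`⟨a', loc_v(H¹(Ψ)(Sh b))⟩_v (mod N, canonical) = Σ_i ⟨x i, loc_n(g_i · b)⟩_{n,N,v}` (`localization_cohomologyMap_coindTateDualMor` +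
`localTatePairingZMod_canonical_coind_eq_sum_layerPairingH1Of` + `cohomologyMap_resCoindFinHomR_localization_shapiroLift`).
[cite: NeukirchSchmidtWingberg2008, I §5 Prop. (1.5.3) (iv), I §6 (1.6.5)] [cite: MilneADT2006, Ch. I §6 (proof of Prop. 6.9)] -/
theorem localTatePairingZMod_canonical_local_shapiroLift_eq_sum [CompactSpace (absoluteGaloisGroup ℚ)]
    [CompactSpace (absoluteGaloisGroup (v.adicCompletion ℚ))] [Fintype (absoluteGaloisGroup ℚ ⧸ κ.layerSubgroup n)]
    {s : absoluteGaloisGroup ℚ ⧸ κ.layerSubgroup n → absoluteGaloisGroup ℚ}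
    (hs : ∀ y, (s y : absoluteGaloisGroup ℚ ⧸ κ.layerSubgroup n) = y)
    (hs1 : s ((1 : absoluteGaloisGroup ℚ) : absoluteGaloisGroup ℚ ⧸ κ.layerSubgroup n) = 1)
    {ι : Type} [Fintype ι] (g : ι → absoluteGaloisGroup ℚ)
    (hbij : Function.Bijective fun q : ι × (absoluteGaloisGroup (v.adicCompletion ℚ) ⧸ layerGroup κ v n) =>
      quotientMapOfHom (κ.layerSubgroup n) (resGalOfEmb (closureEmb (K := ℚ) (v.adicCompletion ℚ))) q.2 *
        (g q.1 : absoluteGaloisGroup ℚ ⧸ κ.layerSubgroup n))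
    (a' : galoisCohomology ((ρM.coind (κ.layerSubgroup n) (κ.isOpen_layerSubgroup n)).toLocal (Sum.inr v)) 1)
    (x : ι → continuousCohomology 1 (subgroupRep (localRepOf ρM v) (layerGroup κ v n)))
    (hx : ∀ i, cohomologyMap (resCoindFinHomR ρM.toTopRep (κ.layerSubgroup n) (resGalOfEmb (closureEmb (K := ℚ) (v.adicCompletion ℚ)))
        (g i : absoluteGaloisGroup ℚ ⧸ κ.layerSubgroup n)) 1 a' = layerShapiroOf ρM κ v n (x i))
    (b : H1 ρM (κ.layerSubgroup n)) :
    localTatePairingZMod (ρM.coind (κ.layerSubgroup n) (κ.isOpen_layerSubgroup n)) N (Sum.inr v)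
        (LocalInvariants.canonical ℚ N (Sum.inr v)) a'
        (galoisCohomology.localization ((ρM.coind (κ.layerSubgroup n) (κ.isOpen_layerSubgroup n)).tateDual N) (Sum.inr v) 1
          (cohomologyMap (coindTateDualMor ρM ρM (κ.layerSubgroup n) (pairingHomOfFun N e hμ hadd₁ hadd₂) (κ.isOpen_layerSubgroup n)
              (fun σ S T => (contPairingOfFun ρM N e hμ hadd₁ hadd₂ hgal).toLin_smul σ S T)) 1
            (shapiroLift ρM.toTopRep (κ.layerSubgroup n) (κ.isOpen_layerSubgroup n) hs hs1 b))) =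
      ∑ i, layerPairingH1Of ρM N e hμ hadd₁ hadd₂ hgal κ v n (x i)
        (layerLocOf ρM κ v n (conjMap ρM.toTopRep (κ.layerSubgroup n) (g i) 1 b)) := by
  rw [localization_cohomologyMap_coindTateDualMor]
  exact localTatePairingZMod_canonical_coind_eq_sum_layerPairingH1Of ρM N e hμ hadd₁ hadd₂ hgal κ v n g hbij a' _ x
    (fun i => layerLocOf ρM κ v n (conjMap ρM.toTopRep (κ.layerSubgroup n) (g i) 1 b)) hx
    (fun i => cohomologyMap_resCoindFinHomR_localization_shapiroLift ρM κ v n hs hs1 (g i) b)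

/-! ## §C Readback of the conclusion: prescribed local class ⟹ prescribed conjugate layer localisations and pairings -/

omit [Finite M] in
/-- **READBACK (conclusion side).** If `loc_v(Sh c) = a'` and `a'` has Mackey components `x i`, then `loc_n(g_i · c) = x i`
(`cohomologyMap_resCoindFinHomR_localization_shapiroLift` + `shapiroLift_injective`). [cite: NeukirchSchmidtWingberg2008, I §6 Prop. (1.6.4)] -/
theorem layerLocOf_conjMap_eq_of_localization_shapiroLift_eq [Fintype (absoluteGaloisGroup ℚ ⧸ κ.layerSubgroup n)]
    {s : absoluteGaloisGroup ℚ ⧸ κ.layerSubgroup n → absoluteGaloisGroup ℚ}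
    (hs : ∀ y, (s y : absoluteGaloisGroup ℚ ⧸ κ.layerSubgroup n) = y)
    (hs1 : s ((1 : absoluteGaloisGroup ℚ) : absoluteGaloisGroup ℚ ⧸ κ.layerSubgroup n) = 1)
    {ι : Type} (g : ι → absoluteGaloisGroup ℚ)
    (a' : galoisCohomology ((ρM.coind (κ.layerSubgroup n) (κ.isOpen_layerSubgroup n)).toLocal (Sum.inr v)) 1)
    (x : ι → continuousCohomology 1 (subgroupRep (localRepOf ρM v) (layerGroup κ v n)))
    (hx : ∀ i, cohomologyMap (resCoindFinHomR ρM.toTopRep (κ.layerSubgroup n) (resGalOfEmb (closureEmb (K := ℚ) (v.adicCompletion ℚ)))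
        (g i : absoluteGaloisGroup ℚ ⧸ κ.layerSubgroup n)) 1 a' = layerShapiroOf ρM κ v n (x i))
    (c : H1 ρM (κ.layerSubgroup n))
    (hc : galoisCohomology.localization (ρM.coind (κ.layerSubgroup n) (κ.isOpen_layerSubgroup n)) (Sum.inr v) 1
      (shapiroLift ρM.toTopRep (κ.layerSubgroup n) (κ.isOpen_layerSubgroup n) hs hs1 c) = a') (i : ι) :
    layerLocOf ρM κ v n (conjMap ρM.toTopRep (κ.layerSubgroup n) (g i) 1 c) = x i := by
  apply shapiroLift_injective (localRepOf ρM v) (layerGroup κ v n) (isOpen_layerGroup κ v n) (layerReps_spec κ v n)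
    (layerReps_one κ v n)
  change layerShapiroOf ρM κ v n _ = layerShapiroOf ρM κ v n _
  rw [← cohomologyMap_resCoindFinHomR_localization_shapiroLift ρM κ v n hs hs1 (g i) c, hc, hx i]

omit [Finite M] in
/-- **READBACK (conclusion side), pairing form.** Under the hypotheses of `layerLocOf_conjMap_eq_of_localization_shapiroLift_eq` and
`⟨x i, ·⟩ = ψ i`: `layerPairingOf … (g_i · c) = ψ i` as functionals on `H¹(U_n, M|)` — the currency of the AwayPins value pin `hlocdS`.
[cite: Kobayashi2003, (8.23) (p. 18)] -/
theorem layerPairingOf_conjMap_eq [Fintype (absoluteGaloisGroup ℚ ⧸ κ.layerSubgroup n)]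
    {s : absoluteGaloisGroup ℚ ⧸ κ.layerSubgroup n → absoluteGaloisGroup ℚ}
    (hs : ∀ y, (s y : absoluteGaloisGroup ℚ ⧸ κ.layerSubgroup n) = y)
    (hs1 : s ((1 : absoluteGaloisGroup ℚ) : absoluteGaloisGroup ℚ ⧸ κ.layerSubgroup n) = 1)
    {ι : Type} (g : ι → absoluteGaloisGroup ℚ)
    (ψ : ι → (continuousCohomology 1 (subgroupRep (localRepOf ρM v) (layerGroup κ v n)) →+ ZMod N))
    (a' : galoisCohomology ((ρM.coind (κ.layerSubgroup n) (κ.isOpen_layerSubgroup n)).toLocal (Sum.inr v)) 1)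
    (x : ι → continuousCohomology 1 (subgroupRep (localRepOf ρM v) (layerGroup κ v n)))
    (hxψ : ∀ i, layerPairingH1Of ρM N e hμ hadd₁ hadd₂ hgal κ v n (x i) = ψ i)
    (hx : ∀ i, cohomologyMap (resCoindFinHomR ρM.toTopRep (κ.layerSubgroup n) (resGalOfEmb (closureEmb (K := ℚ) (v.adicCompletion ℚ)))
        (g i : absoluteGaloisGroup ℚ ⧸ κ.layerSubgroup n)) 1 a' = layerShapiroOf ρM κ v n (x i))
    (c : H1 ρM (κ.layerSubgroup n))
    (hc : galoisCohomology.localization (ρM.coind (κ.layerSubgroup n) (κ.isOpen_layerSubgroup n)) (Sum.inr v) 1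
      (shapiroLift ρM.toTopRep (κ.layerSubgroup n) (κ.isOpen_layerSubgroup n) hs hs1 c) = a') (i : ι) :
    layerPairingOf ρM N e hμ hadd₁ hadd₂ hgal κ v n (conjMap ρM.toTopRep (κ.layerSubgroup n) (g i) 1 c) = ψ i :=
  AddMonoidHom.ext fun y => by
    rw [layerPairingOf_apply, layerLocOf_conjMap_eq_of_localization_shapiroLift_eq ρM κ v n hs hs1 g a' x hx c hc i, hxψ i]

end Generic

/-! ## §D The one-call S4₀ levelwise theorem in layer currency (ρ-coefficients, p694988's binders) -/

section Rho

variable {p : ℕ} [Fact p.Prime] (S : Set (PadicAlgCl p)) {d : ℕ} (ρ : FramedGaloisRep ℚ ↥(padicCoeffIntegers S) d) (k : ℕ)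
  [Finite ↥(AddSubgroup.torsionBy (Cofree ρ ↥(padicCoeffField S)) ((p ^ k : ℕ) : ℤ))]
  (ePk : ∀ k : ℕ, ↥(AddSubgroup.torsionBy (Cofree ρ ↥(padicCoeffField S)) ((p ^ k : ℕ) : ℤ)) →
    ↥(AddSubgroup.torsionBy (Cofree ρ ↥(padicCoeffField S)) ((p ^ k : ℕ) : ℤ)) → AlgebraicClosure ℚ)
  (hμPk : ∀ k a b, ePk k a b ^ (p ^ k) = 1)
  (hadd₁Pk : ∀ k a₁ a₂ b, ePk k (a₁ + a₂) b = ePk k a₁ b * ePk k a₂ b)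
  (hadd₂Pk : ∀ k a b₁ b₂, ePk k a (b₁ + b₂) = ePk k a b₁ * ePk k a b₂)
  (hgalPk : ∀ k (σ : absoluteGaloisGroup ℚ) (a b : ↥(AddSubgroup.torsionBy (Cofree ρ ↥(padicCoeffField S)) ((p ^ k : ℕ) : ℤ))),
    σ • ePk k a b = ePk k (cofreeTorsionGaloisModule S ρ _ σ a) (cofreeTorsionGaloisModule S ρ _ σ b))
  (hnondeg : ∀ T, (∀ a, ePk k a T = 1) → T = 0)
  (κ : ZpExtension ℚ p)
  (S₀ : Finset (HeightOneSpectrum (𝓞 ℚ))) (hS₀ : ∀ w ∈ S₀, (p : 𝓞 ℚ) ∉ w.asIdeal)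
  (hρ : ∀ w : HeightOneSpectrum (𝓞 ℚ), w ∉ S₀ → (p : 𝓞 ℚ) ∉ w.asIdeal → ρ.IsUnramifiedAt w)
  (n : ℕ) [Fintype (absoluteGaloisGroup ℚ ⧸ κ.layerSubgroup n)]
  {s : absoluteGaloisGroup ℚ ⧸ κ.layerSubgroup n → absoluteGaloisGroup ℚ}
  (hs : ∀ x : absoluteGaloisGroup ℚ ⧸ κ.layerSubgroup n, (s x : absoluteGaloisGroup ℚ ⧸ κ.layerSubgroup n) = x)
  (hs1 : s ((1 : absoluteGaloisGroup ℚ) : absoluteGaloisGroup ℚ ⧸ κ.layerSubgroup n) = 1)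

include hnondeg hS₀ hρ in
set_option maxHeartbeats 3200000 in
/-- **GLUE-7 CONCRETE — the S4₀ levelwise call in LAYER currency (weakest sufficient hypothesis, strongest levelwise conclusion).**
For orbit representatives `g w : ι w → Γ_ℚ` at the places `w ∈ S₀` (`hbij`, e.g. `exists_orbitReps_bijective`) and per-orbit level
characters `ψ w i : H¹(U_{n,w}, A_ρ[p^k]|) →+ ℤ/p^k`, the ORBIT-SUMMED orthogonality
`hsum : ∀ b, [unr] → [inf] → [p] → Σ_{w ∈ S₀} Σ_i ψ w i (loc_n(g_{w,i} · b)) = 0`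
yields `c ∈ H¹(Γ_n, A_ρ[p^k])` ADMISSIBLE outside `S₀ ∪ {w ∋ p}` with `layerPairingOf … κ w n (g_{w,i} · c) = ψ w i` for all `w ∈ S₀`, `i`
(so `a = 1` at this level). Proof: §A synthesises the prescribed `t w`; p694988 `exists_admissible_prescribed_of_levelwise_orthogonal`;
§B reads its `hT` summands as `Σ_i ψ w i (loc_n(g_{w,i} · b))`; §C reads the conclusion back. CONDITIONAL on `hsum`; credit nothing;
BSD is not proved by this. [cite: MilneADT2006, Ch. I, Thm. 4.10(b), Cor. 2.3] [cite: NeukirchSchmidtWingberg2008, I §6 Prop. (1.6.4)]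
[cite: Kobayashi2003, (8.23) (p. 18)] -/
theorem exists_admissible_layerPairingOf_eq_of_orbitSum_orthogonal [CompactSpace (absoluteGaloisGroup ℚ)]
    [∀ w : HeightOneSpectrum (𝓞 ℚ), CompactSpace (absoluteGaloisGroup (w.adicCompletion ℚ))]
    (ι : HeightOneSpectrum (𝓞 ℚ) → Type) [∀ w, Fintype (ι w)]
    (g : ∀ w : HeightOneSpectrum (𝓞 ℚ), ι w → absoluteGaloisGroup ℚ)
    (hbij : ∀ w ∈ S₀, Function.Bijective fun q : ι w × (absoluteGaloisGroup (w.adicCompletion ℚ) ⧸ layerGroup κ w n) =>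
      quotientMapOfHom (κ.layerSubgroup n) (resGalOfEmb (closureEmb (K := ℚ) (w.adicCompletion ℚ))) q.2 *
        (g w q.1 : absoluteGaloisGroup ℚ ⧸ κ.layerSubgroup n))
    (ψ : ∀ w : HeightOneSpectrum (𝓞 ℚ), ι w →
      (continuousCohomology 1 (subgroupRep (localRepOf (cofreeTorsionGaloisModule S ρ ((p ^ k : ℕ) : ℤ)) w) (layerGroup κ w n)) →+
        ZMod (p ^ k)))
    (hsum : ∀ (b : H1 (cofreeTorsionGaloisModule S ρ ((p ^ k : ℕ) : ℤ)) (κ.layerSubgroup n)),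
      (∀ w : HeightOneSpectrum (𝓞 ℚ), w ∉ S₀ → (p : 𝓞 ℚ) ∉ w.asIdeal →
        galoisCohomology.localization
            ((cofreeTorsionGaloisModule S ρ ((p ^ k : ℕ) : ℤ)).coind (κ.layerSubgroup n) (κ.isOpen_layerSubgroup n)) (Sum.inr w) 1
            (shapiroLift (cofreeTorsionGaloisModule S ρ ((p ^ k : ℕ) : ℤ)).toTopRep (κ.layerSubgroup n) (κ.isOpen_layerSubgroup n)
              hs hs1 b) ∈
          unramifiedSubgroup (GaloisRep.toLocal w
            ((cofreeTorsionGaloisModule S ρ ((p ^ k : ℕ) : ℤ)).coind (κ.layerSubgroup n) (κ.isOpen_layerSubgroup n))) 1) →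
      (∀ w : InfinitePlace ℚ,
        galoisCohomology.localization
            ((cofreeTorsionGaloisModule S ρ ((p ^ k : ℕ) : ℤ)).coind (κ.layerSubgroup n) (κ.isOpen_layerSubgroup n)) (Sum.inl w) 1
            (shapiroLift (cofreeTorsionGaloisModule S ρ ((p ^ k : ℕ) : ℤ)).toTopRep (κ.layerSubgroup n) (κ.isOpen_layerSubgroup n)
              hs hs1 b) = 0) →
      (∀ v : HeightOneSpectrum (𝓞 ℚ), (p : 𝓞 ℚ) ∈ v.asIdeal →
        galoisCohomology.localization
            ((cofreeTorsionGaloisModule S ρ ((p ^ k : ℕ) : ℤ)).coind (κ.layerSubgroup n) (κ.isOpen_layerSubgroup n)) (Sum.inr v) 1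
            (shapiroLift (cofreeTorsionGaloisModule S ρ ((p ^ k : ℕ) : ℤ)).toTopRep (κ.layerSubgroup n) (κ.isOpen_layerSubgroup n)
              hs hs1 b) = 0) →
      ∑ w ∈ S₀, ∑ i, ψ w i (layerLocOf (cofreeTorsionGaloisModule S ρ ((p ^ k : ℕ) : ℤ)) κ w n
        (conjMap (cofreeTorsionGaloisModule S ρ ((p ^ k : ℕ) : ℤ)).toTopRep (κ.layerSubgroup n) (g w i) 1 b)) = 0) :
    ∃ c : H1 (cofreeTorsionGaloisModule S ρ ((p ^ k : ℕ) : ℤ)) (κ.layerSubgroup n),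
      (∀ w : HeightOneSpectrum (𝓞 ℚ), w ∉ ((↑S₀ : Set (HeightOneSpectrum (𝓞 ℚ))) ∪ {u | (p : 𝓞 ℚ) ∈ u.asIdeal}) →
        ∀ 𝔓 ∈ w.primesAbove,
          resLe (cofreeTorsionGaloisModule S ρ ((p ^ k : ℕ) : ℤ)).toTopRep
            (inf_le_left : κ.layerSubgroup n ⊓ 𝔓.inertia (absoluteGaloisGroup ℚ) ≤ κ.layerSubgroup n) 1 c = 0) ∧
      ∀ w ∈ S₀, ∀ i : ι w,
        layerPairingOf (cofreeTorsionGaloisModule S ρ ((p ^ k : ℕ) : ℤ)) (p ^ k) (ePk k) (hμPk k) (hadd₁Pk k) (hadd₂Pk k) (hgalPk k)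
            κ w n (conjMap (cofreeTorsionGaloisModule S ρ ((p ^ k : ℕ) : ℤ)).toTopRep (κ.layerSubgroup n) (g w i) 1 c) =
          ψ w i := by
  haveI : NeZero (p ^ k) := ⟨pow_ne_zero k (Fact.out : p.Prime).ne_zero⟩
  have hN : ∀ m : ↥(AddSubgroup.torsionBy (Cofree ρ ↥(padicCoeffField S)) ((p ^ k : ℕ) : ℤ)), (p ^ k) • m = 0 :=
    fun m => AddSubgroup.torsionBy.nsmul m
  -- §A at every `w ∈ S₀`
  have hsyn : ∀ w ∈ S₀, ∃ (a' : galoisCohomology (((cofreeTorsionGaloisModule S ρ ((p ^ k : ℕ) : ℤ)).coind (κ.layerSubgroup n)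
        (κ.isOpen_layerSubgroup n)).toLocal (Sum.inr w)) 1)
      (x : ι w → continuousCohomology 1 (subgroupRep (localRepOf (cofreeTorsionGaloisModule S ρ ((p ^ k : ℕ) : ℤ)) w)
        (layerGroup κ w n))),
      (∀ i, layerPairingH1Of (cofreeTorsionGaloisModule S ρ ((p ^ k : ℕ) : ℤ)) (p ^ k) (ePk k) (hμPk k) (hadd₁Pk k) (hadd₂Pk k)
        (hgalPk k) κ w n (x i) = ψ w i) ∧
      ∀ i, cohomologyMap (resCoindFinHomR (cofreeTorsionGaloisModule S ρ ((p ^ k : ℕ) : ℤ)).toTopRep (κ.layerSubgroup n)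
        (resGalOfEmb (closureEmb (K := ℚ) (w.adicCompletion ℚ))) (g w i : absoluteGaloisGroup ℚ ⧸ κ.layerSubgroup n)) 1 a' =
          layerShapiroOf (cofreeTorsionGaloisModule S ρ ((p ^ k : ℕ) : ℤ)) κ w n (x i) :=
    fun w hw => exists_local_components_layerPairingH1Of_eq (cofreeTorsionGaloisModule S ρ ((p ^ k : ℕ) : ℤ)) (p ^ k) (ePk k)
      (hμPk k) (hadd₁Pk k) (hadd₂Pk k) (hgalPk k) κ w n hnondeg hN (g w) (hbij w hw) (ψ w)
  -- the prescribed local classes (junk `0` off `S₀`)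
  let t : ∀ w : HeightOneSpectrum (𝓞 ℚ), galoisCohomology (((cofreeTorsionGaloisModule S ρ ((p ^ k : ℕ) : ℤ)).coind
      (κ.layerSubgroup n) (κ.isOpen_layerSubgroup n)).toLocal (Sum.inr w)) 1 :=
    fun w => if hw : w ∈ S₀ then (hsyn w hw).choose else 0
  have ht : ∀ w (hw : w ∈ S₀), t w = (hsyn w hw).choose := fun w hw => dif_pos hw
  obtain ⟨c, hadm, hloc⟩ := ThetaTransport.DeepHalfLevelwiseAway.exists_admissible_prescribed_of_levelwise_orthogonal S ρ k ePk
    hμPk hadd₁Pk hadd₂Pk hgalPk hnondeg κ S₀ hS₀ hρ n hs hs1 t (fun b hunr hinf hp => by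
      refine (Finset.sum_congr rfl fun w hw => ?_).trans (hsum b hunr hinf hp)
      obtain ⟨x, hxψ, hxa⟩ := (hsyn w hw).choose_spec
      rw [ht w hw, localTatePairingZMod_canonical_local_shapiroLift_eq_sum (cofreeTorsionGaloisModule S ρ ((p ^ k : ℕ) : ℤ)) (p ^ k)
        (ePk k) (hμPk k) (hadd₁Pk k) (hadd₂Pk k) (hgalPk k) κ w n hs hs1 (g w) (hbij w hw) _ x hxa b]
      exact Finset.sum_congr rfl fun i _ => by rw [hxψ i])
  refine ⟨c, hadm, fun w hw i => ?_⟩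
  obtain ⟨x, hxψ, hxa⟩ := (hsyn w hw).choose_spec
  exact layerPairingOf_conjMap_eq (cofreeTorsionGaloisModule S ρ ((p ^ k : ℕ) : ℤ)) (p ^ k) (ePk k) (hμPk k) (hadd₁Pk k)
    (hadd₂Pk k) (hgalPk k) κ w n hs hs1 (g w) (ψ w) _ x hxψ hxa c ((hloc w hw).trans (ht w hw)) i

end Rho

/-! ## §E Currency: `AddCircle`-valued characters of `N`-torsion groups factor through `ℤ/N` (frame `CharacterModule (Dloc w)` ∘ `jAway` ↦ `ψ`) -/

section Currency

/-- The generator `u₀ = 1/N` of the `N`-torsion of `ℚ/ℤ` has additive order `N`. -/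
theorem addOrderOf_coe_one_div (N : ℕ) [NeZero N] :
    addOrderOf ((((1 : ℚ) / N : ℚ)) : AddCircle (1 : ℚ)) = N :=
  AddCircle.addOrderOf_period_div (Nat.pos_of_ne_zero (NeZero.ne N))

/-- Every `N`-torsion element of `ℚ/ℤ` is a multiple of `1/N`. -/
theorem exists_nsmul_one_div_of_nsmul_eq_zero (N : ℕ) [NeZero N] (u : AddCircle (1 : ℚ)) (hu : N • u = 0) :
    ∃ m : ℕ, u = m • ((((1 : ℚ) / N : ℚ)) : AddCircle (1 : ℚ)) := by
  have hN : 0 < N := Nat.pos_of_ne_zero (NeZero.ne N)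
  have hfin : IsOfFinAddOrder u := isOfFinAddOrder_iff_nsmul_eq_zero.mpr ⟨N, hN, hu⟩
  obtain ⟨m, -, -, hm⟩ := AddCircle.exists_gcd_eq_one_of_isOfFinAddOrder hfin
  have hdvd : addOrderOf u ∣ N := addOrderOf_dvd_of_nsmul_eq_zero hu
  obtain ⟨q, hq⟩ := hdvd
  have hn0 : 0 < addOrderOf u := hfin.addOrderOf_pos
  refine ⟨m * q, ?_⟩
  rw [← hm, ← AddCircle.coe_nsmul]
  congr 1
  have hn0' : (addOrderOf u : ℚ) ≠ 0 := by exact_mod_cast hn0.ne'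
  have hq0 : q ≠ 0 := by
    rintro rfl
    rw [mul_zero] at hq
    exact hN.ne' hq
  have hq0' : (q : ℚ) ≠ 0 := by exact_mod_cast hq0
  rw [nsmul_eq_mul, hq]
  push_cast
  field_simp

/-- **The injection `ℤ/N ↪ ℚ/ℤ`, `m ↦ m.val • (1/N)`, is an additive monomorphism** (so `ℤ/N`-valued identities can be read in
`AddCircle` currency and back). [cite: MilneADT2006, Ch. I §0] -/
theorem exists_injective_zmodToAddCircle (N : ℕ) [NeZero N] :
    ∃ j : ZMod N →+ AddCircle (1 : ℚ), Function.Injective j ∧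
      ∀ m : ZMod N, j m = m.val • ((((1 : ℚ) / N : ℚ)) : AddCircle (1 : ℚ)) := by
  set u₀ : AddCircle (1 : ℚ) := ((((1 : ℚ) / N : ℚ)) : AddCircle (1 : ℚ)) with hu₀
  have hord : addOrderOf u₀ = N := addOrderOf_coe_one_div N
  have hkill : (zmultiplesHom (AddCircle (1 : ℚ)) u₀ : ℤ →+ AddCircle (1 : ℚ)) (N : ℤ) = 0 := by
    simp only [zmultiplesHom_apply, natCast_zsmul]
    rw [← hord]
    exact addOrderOf_nsmul_eq_zero u₀
  let j : ZMod N →+ AddCircle (1 : ℚ) := ZMod.lift N ⟨(zmultiplesHom (AddCircle (1 : ℚ)) u₀ : ℤ →+ AddCircle (1 : ℚ)), hkill⟩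
  have hj : ∀ m : ZMod N, j m = m.val • u₀ := by
    intro m
    conv_lhs => rw [← ZMod.natCast_zmod_val m]
    rw [← Int.cast_natCast, ZMod.lift_coe]
    simp only [zmultiplesHom_apply, natCast_zsmul]
  refine ⟨j, ?_, hj⟩
  rw [injective_iff_map_eq_zero]
  intro m hm
  rw [hj] at hm
  have hdvd : N ∣ m.val := by
    have h := addOrderOf_dvd_of_nsmul_eq_zero hm
    rwa [hord] at h
  exact (ZMod.val_eq_zero m).mp (Nat.eq_zero_of_dvd_of_lt hdvd (ZMod.val_lt m))

/-- **A `ℤ/N`-valued sum vanishes if its `AddCircle` reading `Σ (m i).val • (1/N)` vanishes** (injectivity + additivity of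
`exists_injective_zmodToAddCircle`): the passage from the frame hypothesis `Σ_{w,c} χ w c (locAway s w c) = 0` (values `(ψ …).val • 2^{-k}`)
to the orbit-summed `ℤ/2^k` hypothesis `hsum` of Sketch2 §D. [cite: MilneADT2006, Ch. I §0] -/
theorem sum_eq_zero_of_sum_val_nsmul_eq_zero (N : ℕ) [NeZero N] {ι : Type*} (s : Finset ι) (m : ι → ZMod N)
    (h : ∑ i ∈ s, (m i).val • ((((1 : ℚ) / N : ℚ)) : AddCircle (1 : ℚ)) = 0) : ∑ i ∈ s, m i = 0 := by
  obtain ⟨j, hjinj, hj⟩ := exists_injective_zmodToAddCircle N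
  apply hjinj
  rw [map_sum, map_zero]
  simpa only [hj] using h

/-- **§E.** An `AddCircle`-valued character of an `N`-torsion abelian group factors through `ℤ/N` along `m ↦ m.val • (1/N)`:
`χ y = (ψ y).val • (1/N)` for an additive `ψ : D →+ ℤ/N` (unique by `exists_injective_zmodToAddCircle`). This is the step
`χ w c ∘ jAway w n k ↦ ψ_{w,c}` from the AwayPins currency `CharacterModule (Dloc w)` to the per-orbit level characters.
[cite: MilneADT2006, Ch. I §0 (Pontryagin duality for finite groups)] -/
theorem exists_zmodChar_of_nsmul_eq_zero {D : Type*} [AddCommGroup D] (N : ℕ) [NeZero N] (hD : ∀ y : D, N • y = 0)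
    (χ : D →+ AddCircle (1 : ℚ)) :
    ∃ ψ : D →+ ZMod N, ∀ y, χ y = (ψ y).val • ((((1 : ℚ) / N : ℚ)) : AddCircle (1 : ℚ)) := by
  classical
  obtain ⟨j, hjinj, hj⟩ := exists_injective_zmodToAddCircle N
  have hj' : ∀ m : ℕ, j (m : ZMod N) = m • ((((1 : ℚ) / N : ℚ)) : AddCircle (1 : ℚ)) := by
    intro m
    rw [hj, ZMod.val_natCast]
    have h := mod_addOrderOf_nsmul ((((1 : ℚ) / N : ℚ)) : AddCircle (1 : ℚ)) m
    rwa [addOrderOf_coe_one_div N] at h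
  -- `χ` lands in the range of `j`
  have hmem : ∀ y, χ y ∈ j.range := by
    intro y
    obtain ⟨m, hm⟩ := exists_nsmul_one_div_of_nsmul_eq_zero N (χ y) (by rw [← map_nsmul, hD, map_zero])
    exact ⟨(m : ZMod N), by rw [hj', hm]⟩
  let e := AddMonoidHom.ofInjective hjinj
  let ψ : D →+ ZMod N := e.symm.toAddMonoidHom.comp (χ.codRestrict j.range hmem)
  refine ⟨ψ, fun y => ?_⟩
  have : j (ψ y) = χ y := by
    show j (e.symm ⟨χ y, hmem y⟩) = χ y
    exact AddMonoidHom.apply_ofInjective_symm hjinj ⟨χ y, hmem y⟩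
  rw [← this, hj]

end Currency


end Summit.BirchSwinnertonDyer.BirchSwinnertonDyer.Cruxes.ResidualThetaCountLowerPureAtTwo.SideaK1G16Away

end
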